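import Summits.Ventures.YMGap.RobustBall.LocalSourceClustering
import Summits.Ventures.YMGap.RobustBall.SourceGeometry
import HarnessLib

/-!
# Venture YMGap, track ROBUST-BALL (Y2) — A BOUNDED LOCAL SOURCE OF ANY STRENGTH CANNOT CLOSE THE MASS GAP: the perturbed state
# clusters between ANY two local observables at rate at least `m/2`

HONEST FRAMING. WHAT THIS IS: a venture file (cell `pub-ymgap`, track Y2 ROBUST-BALL, seat rb-p1, theorems only), the two-sided form of
`LocalSourceClustering.lean`.  There the tilt `ν = e^{−H}μ/μ(e^{−H})` of a clustering state (`(m, A)`) by a local density (`H` a Lipschitz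
cylinder on `S`, `|H| ≤ B`) was shown to cluster at rate `m` in the ONE-SIDED distance `d(Λ_F ∪ S, Λ_G)`.  The elementary geometry
`d(Λ_F, Λ_G) ≤ 2 · max(d(Λ_F ∪ S, Λ_G), d(Λ_G ∪ S, Λ_F)) + diam S` (`setDistEdges_le_two_mul_max_add`) and the symmetry of the covariance
turn this into a genuine MASS-GAP statement for the perturbed state (geometry and the trivial covariance bound: `SourceGeometry.lean`):
* ★ `abs_cov_tilted_le_halfRate` — for `A ≥ 1`, `m ≥ 0`, `S` of `ℓ^∞`-diameter `≤ δ`, Lipschitz cylinders `F` (`Λ_F`, `K_F`, `|F| ≤ M_F`),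
  `G` (`Λ_G`, `K_G`, `|G| ≤ M_G`) with `Λ_F ∩ Λ_G = ∅` and `|Λ_F ∪ S|, |Λ_G ∪ S| ≤ n` — NO CONDITION on the position of the source —
  `|cov_ν(F, G)| ≤ A n² e^{2B} e^{mδ/2} · e^{−(m/2) d(Λ_F, Λ_G)} · (K_F K_G + 2 K_S (M_F K_G + M_G K_F) + 2 M_F M_G)`:
  THE PERTURBED STATE HAS A MASS GAP (inverse correlation length) AT LEAST `m/2`, whatever the strength `B` and wherever the source
  sits; strength and size of the source enter the CONSTANT only (`e^{2B + mδ/2}`, `K_S`);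
* lattice forms `abs_cov_le_halfRate_of_mem_perturbedGibbsMeasures_add` (tier 1: every DLR state of `W + V`),
  `abs_cov_le_halfRate_of_uniformMassGapOnBallZdG_add` (ds-2's gauge-invariant ball), `abs_cov_le_halfRate_of_mem_perturbedGibbsMeasuresS_add` /
  `abs_cov_le_halfRate_of_uniformMassGapOnBallZdS_add` (tier 2, the weighted ball); the Wilson-point cells (every `N ≥ 2`, `SU(2)` at the
  logarithmic rate) are in `LocalSourceWilson.lean`.
WHAT THIS IS NOT: the rate `m/2` is an artefact of the two-sided bookkeeping (no claim of optimality); sources with finitely many terms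
only; lattice, strong coupling (the rows); nothing about the continuum limit or a Clay-sense mass gap.
-/

noncomputable section

open MeasureTheory Function Finset Real ProbabilityTheory
open scoped NNReal
open Literature.Probability.LatticeModels
open Literature.MathematicalPhysics.QuantumLattice
open Literature.MathematicalPhysics.QuantumFieldTheory hiding ZdEdge Site
open Summit.Ventures.YMGap.CouplingResponse

namespace Summit.Ventures.YMGap.RobustBall

variable {d N : ℕ}

/-! ### The perturbed state has a mass gap at least `m/2` -/

section MassGap

variable {β m A : ℝ} {W : Potential (ZdEdge d) (SUN N)} {supp : Finset (ZdEdge d) → Finset (Finset (ZdEdge d))}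

/-- ★ **THE TILT OF A CLUSTERING PROBABILITY MEASURE BY A LOCAL DENSITY HAS A MASS GAP AT LEAST `m/2`** (state-level core: `μ` any
probability measure on gauge fields whose covariances of Lipschitz cylinders obey the `(m, A)` clustering bound, `m ≥ 0`, `A ≥ 1`).  `H` a
Lipschitz cylinder on `S` (constant `K_S`, `|H| ≤ B`), `S` of `ℓ^∞`-diameter `≤ δ` (`δ ≥ 0`); `F`, `G` Lipschitz cylinders on DISJOINT `Λ_F`,
`Λ_G` (constants `K_F, K_G`, bounds `M_F, M_G`), `|Λ_F ∪ S|, |Λ_G ∪ S| ≤ n`.  Then, wherever the source sits,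
`|cov_{μ.tilted(−H)}(F, G)| ≤ A n² e^{2B} e^{mδ/2} e^{−(m/2) d(Λ_F, Λ_G)} (K_F K_G + 2 K_S (M_F K_G + M_G K_F) + 2 M_F M_G)`. -/
theorem abs_cov_tilted_le_halfRate_of_clustering {m A : ℝ} {μ : Measure (LGConfig d (SUN N))} [IsProbabilityMeasure μ]
    (hclμ : ∀ (n : ℕ) (F₁ F₂ : LGConfig d (SUN N) → ℝ) (Λ₁ Λ₂ : Finset (ZdEdge d)) (K₁ K₂ : ℝ≥0),
      Λ₁.card ≤ n → Λ₂.card ≤ n → Disjoint Λ₁ Λ₂ →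
      IsLipschitzCylinder (fundamentalRep (Fin N)) F₁ Λ₁ K₁ → IsLipschitzCylinder (fundamentalRep (Fin N)) F₂ Λ₂ K₂ →
        |cov[F₁, F₂; μ]| ≤ A * (n : ℝ) ^ 2 * Real.exp (-m * setDistEdges Λ₁ Λ₂) *
          ((K₁ : ℝ) * K₂ + Real.sqrt (∫ U, F₁ U ^ 2 ∂μ) * Real.sqrt (∫ U, F₂ U ^ 2 ∂μ)))
    (hm : 0 ≤ m) (hA : 1 ≤ A) {H : LGConfig d (SUN N) → ℝ} {S : Finset (ZdEdge d)} {KS : ℝ≥0}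
    (hH : IsLipschitzCylinder (fundamentalRep (Fin N)) H S KS) {B : ℝ} (hHB : ∀ U, |H U| ≤ B)
    {δ : ℝ} (hδ0 : 0 ≤ δ) (hδ : ∀ s ∈ S, ∀ s' ∈ S, ‖s.1 - s'.1‖ ≤ δ)
    {n : ℕ} {F G : LGConfig d (SUN N) → ℝ} {ΛF ΛG : Finset (ZdEdge d)} {KF KG MF MG : ℝ≥0}
    (hF : IsLipschitzCylinder (fundamentalRep (Fin N)) F ΛF KF) (hMF : ∀ U, |F U| ≤ MF)
    (hG : IsLipschitzCylinder (fundamentalRep (Fin N)) G ΛG KG) (hMG : ∀ U, |G U| ≤ MG)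
    (hn₁ : (ΛF ∪ S).card ≤ n) (hn₂ : (ΛG ∪ S).card ≤ n) (hdisj : Disjoint ΛF ΛG) :
    |cov[F, G; μ.tilted fun U => -H U]| ≤
      A * (n : ℝ) ^ 2 * exp (2 * B) * exp (m * δ / 2) * exp (-(m / 2) * setDistEdges ΛF ΛG) *
        ((KF : ℝ) * KG + 2 * KS * (MF * KG + MG * KF) + 2 * MF * MG) := by
  classical
  have hA0 : 0 ≤ A := zero_le_one.trans hA
  -- abbreviations (plain variables with defining equations, no `let`)
  obtain ⟨x, hx⟩ : ∃ x : ℝ, x = setDistEdges (ΛF ∪ S) ΛG := ⟨_, rfl⟩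
  obtain ⟨y, hy⟩ : ∃ y : ℝ, y = setDistEdges (ΛG ∪ S) ΛF := ⟨_, rfl⟩
  obtain ⟨D, hD⟩ : ∃ D : ℝ, D = setDistEdges ΛF ΛG := ⟨_, rfl⟩
  obtain ⟨Csym, hCsym⟩ : ∃ C : ℝ, C = (KF : ℝ) * KG + 2 * KS * (MF * KG + MG * KF) + 2 * MF * MG := ⟨_, rfl⟩
  obtain ⟨P, hP⟩ : ∃ P : ℝ, P = A * (n : ℝ) ^ 2 * exp (2 * B) := ⟨_, rfl⟩
  rw [← hD, ← hCsym, ← hP]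
  have hKF : (0 : ℝ) ≤ KF := KF.2
  have hKG : (0 : ℝ) ≤ KG := KG.2
  have hKS : (0 : ℝ) ≤ KS := KS.2
  have hMF0 : (0 : ℝ) ≤ MF := MF.2
  have hMG0 : (0 : ℝ) ≤ MG := MG.2
  have hx0 : 0 ≤ x := by rw [hx]; exact setDistEdges_nonneg _ _
  have hy0 : 0 ≤ y := by rw [hy]; exact setDistEdges_nonneg _ _
  have hP0 : 0 ≤ P := by
    rw [hP]; exact mul_nonneg (mul_nonneg hA0 (pow_nonneg (Nat.cast_nonneg n) 2)) (exp_pos _).le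
  have hCsym0 : 0 ≤ Csym := by
    rw [hCsym]
    have h1 : (0 : ℝ) ≤ KF * KG := mul_nonneg hKF hKG
    have h2 : (0 : ℝ) ≤ 2 * KS * (MF * KG + MG * KF) :=
      mul_nonneg (mul_nonneg zero_le_two hKS) (add_nonneg (mul_nonneg hMF0 hKG) (mul_nonneg hMG0 hKF))
    have h3 : (0 : ℝ) ≤ 2 * MF * MG := mul_nonneg (mul_nonneg zero_le_two hMF0) hMG0
    linarith
  have hC1 : (KF : ℝ) * KG + 2 * MF * KS * KG + 2 * MF * MG ≤ Csym := by
    have e : Csym - ((KF : ℝ) * KG + 2 * MF * KS * KG + 2 * MF * MG) = 2 * KS * (MG * KF) := by rw [hCsym]; ring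
    have p : (0 : ℝ) ≤ 2 * KS * (MG * KF) := mul_nonneg (mul_nonneg zero_le_two hKS) (mul_nonneg hMG0 hKF)
    linarith
  have hC2 : (KG : ℝ) * KF + 2 * MG * KS * KF + 2 * MG * MF ≤ Csym := by
    have e : Csym - ((KG : ℝ) * KF + 2 * MG * KS * KF + 2 * MG * MF) = 2 * KS * (MF * KG) := by rw [hCsym]; ring
    have p : (0 : ℝ) ≤ 2 * KS * (MF * KG) := mul_nonneg (mul_nonneg zero_le_two hKS) (mul_nonneg hMF0 hKG)
    linarith
  -- geometry: `e^{-m max(x,y)} ≤ e^{mδ/2} e^{-(m/2) D}`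
  have hgeo : D ≤ 2 * max x y + δ := by
    rw [hD, hx, hy]; exact setDistEdges_le_two_mul_max_add hδ0 hδ
  have hexp_max : exp (-m * max x y) ≤ exp (m * δ / 2) * exp (-(m / 2) * D) := by
    rw [← Real.exp_add]
    refine exp_le_exp.2 ?_
    have h1 : m * D ≤ m * (2 * max x y + δ) := mul_le_mul_of_nonneg_left hgeo hm
    have h2 : m * (2 * max x y + δ) = 2 * (m * max x y) + m * δ := by ring
    have h3 : -m * max x y = -(m * max x y) := by ring
    have h4 : m * δ / 2 + -(m / 2) * D = (m * δ - m * D) / 2 := by ring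
    rw [h2] at h1
    rw [h3, h4]
    linarith
  have hnsub₁ : ΛG.card ≤ n := (Finset.card_le_card Finset.subset_union_left).trans hn₂
  have hnsub₂ : ΛF.card ≤ n := (Finset.card_le_card Finset.subset_union_left).trans hn₁
  -- the probability measure `ν`
  have hint : Integrable (fun U => exp (-H U)) μ :=
    Integrable.of_bound hH.measurable.neg.exp.aestronglyMeasurable (exp B) (ae_of_all _ fun U => by
      rw [Real.norm_eq_abs, abs_of_pos (exp_pos _)]; exact exp_le_exp.2 (by linarith [(abs_le.1 (hHB U)).1]))
  haveI : IsProbabilityMeasure (μ.tilted fun U => -H U) := isProbabilityMeasure_tilted hint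
  -- from a one-sided bound at a distance `z ≥ max x y` to the final shape
  have finish : ∀ {z : ℝ}, max x y ≤ z → |cov[F, G; μ.tilted fun U => -H U]| ≤ P * exp (-m * z) * Csym →
      |cov[F, G; μ.tilted fun U => -H U]| ≤ P * exp (m * δ / 2) * exp (-(m / 2) * D) * Csym := by
    intro z hz h
    refine h.trans ?_
    have he : exp (-m * z) ≤ exp (m * δ / 2) * exp (-(m / 2) * D) := by
      refine (exp_le_exp.2 ?_).trans hexp_max
      have h1 : m * max x y ≤ m * z := mul_le_mul_of_nonneg_left hz hm
      rw [neg_mul, neg_mul]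
      linarith
    have h2 : P * exp (-m * z) * Csym = P * (exp (-m * z) * Csym) := mul_assoc _ _ _
    have h3 : P * exp (m * δ / 2) * exp (-(m / 2) * D) * Csym = P * (exp (m * δ / 2) * exp (-(m / 2) * D) * Csym) := by ring
    rw [h2, h3]
    exact mul_le_mul_of_nonneg_left (mul_le_mul_of_nonneg_right he hCsym0) hP0
  -- the direct one-sided bound (source away from `Λ_G`), at distance `x`
  have direct : Disjoint S ΛG → |cov[F, G; μ.tilted fun U => -H U]| ≤ P * exp (-m * x) * Csym := by
    intro hSG
    have hdj : Disjoint (ΛF ∪ S) ΛG := Finset.disjoint_union_left.2 ⟨hdisj, hSG⟩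
    have h1 := abs_cov_tilted_le_of_clustering hclμ hA0 hH hHB hF hMF hG hMG hn₁ hnsub₁ hdj
    rw [← hx, ← hP] at h1
    exact h1.trans (mul_le_mul_of_nonneg_left hC1 (mul_nonneg hP0 (exp_pos _).le))
  -- the swapped one-sided bound (source away from `Λ_F`), at distance `y`
  have swapped : Disjoint S ΛF → |cov[F, G; μ.tilted fun U => -H U]| ≤ P * exp (-m * y) * Csym := by
    intro hSF
    have hdj : Disjoint (ΛG ∪ S) ΛF := Finset.disjoint_union_left.2 ⟨hdisj.symm, hSF⟩
    have h1 := abs_cov_tilted_le_of_clustering hclμ hA0 hH hHB hG hMG hF hMF hn₂ hnsub₂ hdj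
    rw [covariance_comm, ← hy, ← hP] at h1
    exact h1.trans (mul_le_mul_of_nonneg_left hC2 (mul_nonneg hP0 (exp_pos _).le))
  by_cases hSG : Disjoint S ΛG
  · by_cases hSF : Disjoint S ΛF
    · -- both one-sided bounds are available: use the larger distance
      rcases le_total x y with hxy | hxy
      · exact finish (max_le hxy le_rfl) (swapped hSF)
      · exact finish (max_le le_rfl hxy) (direct hSG)
    · -- the source meets `Λ_F`: `y = 0`, `max x y = x`
      have hy0' : y = 0 := by rw [hy]; exact setDistEdges_union_eq_zero_of_not_disjoint hSF
      exact finish (max_le le_rfl (by rw [hy0']; exact hx0)) (direct hSG)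
  · by_cases hSF : Disjoint S ΛF
    · have hx0' : x = 0 := by rw [hx]; exact setDistEdges_union_eq_zero_of_not_disjoint hSG
      exact finish (max_le (by rw [hx0']; exact hy0) le_rfl) (swapped hSF)
    · -- the source meets both: `D ≤ δ`, trivial bound
      have hDδ : D ≤ δ := by rw [hD]; exact setDistEdges_le_of_meets hδ hSF hSG
      obtain ⟨s, hsS, -⟩ := Finset.not_disjoint_iff.1 hSF
      have hn1 : (1 : ℝ) ≤ n := by
        have : 1 ≤ (ΛG ∪ S).card := Finset.card_pos.2 ⟨s, Finset.mem_union_right _ hsS⟩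
        exact_mod_cast this.trans hn₂
      have hB0 : 0 ≤ B := (abs_nonneg _).trans (hHB 1)
      have htriv := abs_covariance_le_two_mul (μ := μ.tilted fun U => -H U) hF.measurable hMF hG.measurable hMG
      refine htriv.trans ?_
      have h1 : (1 : ℝ) ≤ P * exp (m * δ / 2) * exp (-(m / 2) * D) := by
        have e1 : (1 : ℝ) ≤ (n : ℝ) ^ 2 := by rw [sq]; exact one_le_mul_of_one_le_of_one_le hn1 hn1
        have e2 : (1 : ℝ) ≤ exp (2 * B) := one_le_exp (by linarith)
        have e3 : (1 : ℝ) ≤ exp (m * δ / 2) * exp (-(m / 2) * D) := by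
          rw [← Real.exp_add]
          refine one_le_exp ?_
          have h5 : m * δ / 2 + -(m / 2) * D = (m * δ - m * D) / 2 := by ring
          rw [h5]
          linarith [mul_le_mul_of_nonneg_left hDδ hm]
        have eP : (1 : ℝ) ≤ P := by
          rw [hP]
          calc (1 : ℝ) = 1 * 1 * 1 := by ring
            _ ≤ A * (n : ℝ) ^ 2 * exp (2 * B) :=
                mul_le_mul (mul_le_mul hA e1 zero_le_one hA0) e2 zero_le_one
                  (mul_nonneg hA0 (pow_nonneg (Nat.cast_nonneg n) 2))
        calc (1 : ℝ) = 1 * 1 := by ring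
          _ ≤ P * (exp (m * δ / 2) * exp (-(m / 2) * D)) := mul_le_mul eP e3 zero_le_one hP0
          _ = P * exp (m * δ / 2) * exp (-(m / 2) * D) := by ring
      have h2 : 2 * (MF : ℝ) * MG ≤ Csym := by
        have e : Csym - 2 * (MF : ℝ) * MG = KF * KG + 2 * KS * (MF * KG + MG * KF) := by rw [hCsym]; ring
        have p : (0 : ℝ) ≤ KF * KG + 2 * KS * (MF * KG + MG * KF) :=
          add_nonneg (mul_nonneg hKF hKG)
            (mul_nonneg (mul_nonneg zero_le_two hKS) (add_nonneg (mul_nonneg hMF0 hKG) (mul_nonneg hMG0 hKF)))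
        linarith
      have h22 : (0 : ℝ) ≤ 2 * MF * MG := mul_nonneg (mul_nonneg zero_le_two hMF0) hMG0
      calc 2 * (MF : ℝ) * MG = 1 * (2 * MF * MG) := by ring
        _ ≤ P * exp (m * δ / 2) * exp (-(m / 2) * D) * Csym :=
            mul_le_mul h1 h2 h22 (zero_le_one.trans h1)

/-- **Member level (tier 1)**: `μ` a DLR state of a member with `PerturbedClustering d N β W supp m A` (`m ≥ 0`, `A ≥ 1`) — the mass-gap bound of
`abs_cov_tilted_le_halfRate_of_clustering` for `μ.tilted (−H)`. -/
theorem abs_cov_tilted_le_halfRate (hcl : PerturbedClustering d N β W supp m A) (hm : 0 ≤ m) (hA : 1 ≤ A)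
    {μ : Measure (LGConfig d (SUN N))} (hμ : μ ∈ perturbedGibbsMeasures (d := d) (fundamentalRep (Fin N)) (N * β) W supp)
    {H : LGConfig d (SUN N) → ℝ} {S : Finset (ZdEdge d)} {KS : ℝ≥0}
    (hH : IsLipschitzCylinder (fundamentalRep (Fin N)) H S KS) {B : ℝ} (hHB : ∀ U, |H U| ≤ B)
    {δ : ℝ} (hδ0 : 0 ≤ δ) (hδ : ∀ s ∈ S, ∀ s' ∈ S, ‖s.1 - s'.1‖ ≤ δ)
    {n : ℕ} {F G : LGConfig d (SUN N) → ℝ} {ΛF ΛG : Finset (ZdEdge d)} {KF KG MF MG : ℝ≥0}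
    (hF : IsLipschitzCylinder (fundamentalRep (Fin N)) F ΛF KF) (hMF : ∀ U, |F U| ≤ MF)
    (hG : IsLipschitzCylinder (fundamentalRep (Fin N)) G ΛG KG) (hMG : ∀ U, |G U| ≤ MG)
    (hn₁ : (ΛF ∪ S).card ≤ n) (hn₂ : (ΛG ∪ S).card ≤ n) (hdisj : Disjoint ΛF ΛG) :
    |cov[F, G; μ.tilted fun U => -H U]| ≤
      A * (n : ℝ) ^ 2 * exp (2 * B) * exp (m * δ / 2) * exp (-(m / 2) * setDistEdges ΛF ΛG) *
        ((KF : ℝ) * KG + 2 * KS * (MF * KG + MG * KF) + 2 * MF * MG) := by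
  haveI := (show IsGibbsMeasure _ μ from hμ).isProbabilityMeasure
  exact abs_cov_tilted_le_halfRate_of_clustering (hcl μ hμ) hm hA hH hHB hδ0 hδ hF hMF hG hMG hn₁ hn₂ hdisj

/-- **Member level (tier 2)**: the same for a DLR state of the SUMMABLE member with `PerturbedClusteringS d N β W m A`. -/
theorem abs_cov_tilted_le_halfRate_S (hcl : PerturbedClusteringS d N β W m A) (hm : 0 ≤ m) (hA : 1 ≤ A)
    {μ : Measure (LGConfig d (SUN N))} (hμ : μ ∈ perturbedGibbsMeasuresS (d := d) (fundamentalRep (Fin N)) (N * β) W)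
    {H : LGConfig d (SUN N) → ℝ} {S : Finset (ZdEdge d)} {KS : ℝ≥0}
    (hH : IsLipschitzCylinder (fundamentalRep (Fin N)) H S KS) {B : ℝ} (hHB : ∀ U, |H U| ≤ B)
    {δ : ℝ} (hδ0 : 0 ≤ δ) (hδ : ∀ s ∈ S, ∀ s' ∈ S, ‖s.1 - s'.1‖ ≤ δ)
    {n : ℕ} {F G : LGConfig d (SUN N) → ℝ} {ΛF ΛG : Finset (ZdEdge d)} {KF KG MF MG : ℝ≥0}
    (hF : IsLipschitzCylinder (fundamentalRep (Fin N)) F ΛF KF) (hMF : ∀ U, |F U| ≤ MF)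
    (hG : IsLipschitzCylinder (fundamentalRep (Fin N)) G ΛG KG) (hMG : ∀ U, |G U| ≤ MG)
    (hn₁ : (ΛF ∪ S).card ≤ n) (hn₂ : (ΛG ∪ S).card ≤ n) (hdisj : Disjoint ΛF ΛG) :
    |cov[F, G; μ.tilted fun U => -H U]| ≤
      A * (n : ℝ) ^ 2 * exp (2 * B) * exp (m * δ / 2) * exp (-(m / 2) * setDistEdges ΛF ΛG) *
        ((KF : ℝ) * KG + 2 * KS * (MF * KG + MG * KF) + 2 * MF * MG) := by
  haveI := (show IsGibbsMeasure _ μ from hμ).isProbabilityMeasure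
  exact abs_cov_tilted_le_halfRate_of_clustering (hcl μ hμ) hm hA hH hHB hδ0 hδ hF hMF hG hMG hn₁ hn₂ hdisj

/-- **TIER 1 — EVERY DLR STATE OF `W + V` HAS A MASS GAP AT LEAST `m/2`** (`W` adapted, bounded, listed by `supp`, with at most one DLR state
`μ` clustering with `(m, A)`, `m ≥ 0`, `A ≥ 1`; source `V` listed by `suppV ⊆ T` with Lipschitz-cylinder terms on sets `X ⊆ S`,
`|Σ_X V_X| ≤ B`, `S` of diameter `≤ δ`): for all Lipschitz cylinders `F`, `G` on disjoint `Λ_F`, `Λ_G` (`|Λ_F ∪ S|, |Λ_G ∪ S| ≤ n`),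
`|cov_ν(F, G)| ≤ A n² e^{2B} e^{mδ/2} e^{−(m/2) d(Λ_F, Λ_G)} (K_F K_G + 2 (Σ_X K_X)(M_F K_G + M_G K_F) + 2 M_F M_G)`. -/
theorem abs_cov_le_halfRate_of_mem_perturbedGibbsMeasures_add (hcl : PerturbedClustering d N β W supp m A) (hm : 0 ≤ m)
    (hA : 1 ≤ A) (hWa : W.IsAdapted) (hWb : ∀ X, ∃ C, ∀ U, |W X U| ≤ C) (hsupp : W.IsSupportedBy supp)
    (huniq : (perturbedGibbsMeasures (d := d) (fundamentalRep (Fin N)) (N * β) W supp).Subsingleton)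
    {μ : Measure (LGConfig d (SUN N))} (hμ : μ ∈ perturbedGibbsMeasures (d := d) (fundamentalRep (Fin N)) (N * β) W supp)
    {V : Potential (ZdEdge d) (SUN N)} (hVa : V.IsAdapted) (hVb : ∀ X, ∃ C, ∀ U, |V X U| ≤ C)
    {suppV : Finset (ZdEdge d) → Finset (Finset (ZdEdge d))} (hsuppV : V.IsSupportedBy suppV)
    {T : Finset (Finset (ZdEdge d))} (hT : ∀ Λ, suppV Λ ⊆ T)
    {K : Finset (ZdEdge d) → ℝ≥0} (hV : ∀ X ∈ T, IsLipschitzCylinder (fundamentalRep (Fin N)) (V X) X (K X))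
    {S : Finset (ZdEdge d)} (hS : ∀ X ∈ T, X ⊆ S) {B : ℝ} (hB : ∀ U, |∑ X ∈ T, V X U| ≤ B)
    {δ : ℝ} (hδ0 : 0 ≤ δ) (hδ : ∀ s ∈ S, ∀ s' ∈ S, ‖s.1 - s'.1‖ ≤ δ)
    {ν : Measure (LGConfig d (SUN N))}
    (hν : ν ∈ perturbedGibbsMeasures (d := d) (fundamentalRep (Fin N)) (N * β) (W + V) (fun Λ => supp Λ ∪ suppV Λ))
    {n : ℕ} {F G : LGConfig d (SUN N) → ℝ} {ΛF ΛG : Finset (ZdEdge d)} {KF KG MF MG : ℝ≥0}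
    (hF : IsLipschitzCylinder (fundamentalRep (Fin N)) F ΛF KF) (hMF : ∀ U, |F U| ≤ MF)
    (hG : IsLipschitzCylinder (fundamentalRep (Fin N)) G ΛG KG) (hMG : ∀ U, |G U| ≤ MG)
    (hn₁ : (ΛF ∪ S).card ≤ n) (hn₂ : (ΛG ∪ S).card ≤ n) (hdisj : Disjoint ΛF ΛG) :
    |cov[F, G; ν]| ≤ A * (n : ℝ) ^ 2 * exp (2 * B) * exp (m * δ / 2) * exp (-(m / 2) * setDistEdges ΛF ΛG) *
      ((KF : ℝ) * KG + 2 * (∑ X ∈ T, K X : ℝ≥0) * (MF * KG + MG * KF) + 2 * MF * MG) := by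
  haveI : SecondCountableTopology (Matrix (Fin N) (Fin N) ℂ) :=
    inferInstanceAs (SecondCountableTopology (Fin N → Fin N → ℂ))
  haveI : SecondCountableTopology (SUN N) := Topology.IsEmbedding.subtypeVal.secondCountableTopology
  have hνeq := eq_tilted_of_mem_perturbedGibbsMeasures_add (fundamentalRep (Fin N)) (continuous_fundamentalRep (Fin N)) (N * β)
    hWa hWb hsupp hVa hVb hsuppV hT huniq hμ hν
  rw [hνeq]
  exact abs_cov_tilted_le_halfRate hcl hm hA hμ (isLipschitzCylinder_finset_sum hV hS) hB hδ0 hδ hF hMF hG hMG hn₁ hn₂ hdisj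

/-- **ON ds-2's GAUGE-INVARIANT BALL** (`UniformMassGapOnBallZdG d N β ε₀ ε₁ R m A`, `A ≥ 1`): every DLR state of `W + V`, for every member
`(W, supp)` and every source as above, has a mass gap at least `m/2` in the sense of `abs_cov_le_halfRate_of_mem_perturbedGibbsMeasures_add`. -/
theorem abs_cov_le_halfRate_of_uniformMassGapOnBallZdG_add {ε₀ ε₁ : ℝ} {R : ℕ} (h : UniformMassGapOnBallZdG d N β ε₀ ε₁ R m A)
    (hA : 1 ≤ A) (hW : MemBallZdG ε₀ ε₁ R W supp)
    {V : Potential (ZdEdge d) (SUN N)} (hVa : V.IsAdapted) (hVb : ∀ X, ∃ C, ∀ U, |V X U| ≤ C)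
    {suppV : Finset (ZdEdge d) → Finset (Finset (ZdEdge d))} (hsuppV : V.IsSupportedBy suppV)
    {T : Finset (Finset (ZdEdge d))} (hT : ∀ Λ, suppV Λ ⊆ T)
    {K : Finset (ZdEdge d) → ℝ≥0} (hV : ∀ X ∈ T, IsLipschitzCylinder (fundamentalRep (Fin N)) (V X) X (K X))
    {S : Finset (ZdEdge d)} (hS : ∀ X ∈ T, X ⊆ S) {B : ℝ} (hB : ∀ U, |∑ X ∈ T, V X U| ≤ B)
    {δ : ℝ} (hδ0 : 0 ≤ δ) (hδ : ∀ s ∈ S, ∀ s' ∈ S, ‖s.1 - s'.1‖ ≤ δ)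
    {ν : Measure (LGConfig d (SUN N))}
    (hν : ν ∈ perturbedGibbsMeasures (d := d) (fundamentalRep (Fin N)) (N * β) (W + V) (fun Λ => supp Λ ∪ suppV Λ))
    {n : ℕ} {F G : LGConfig d (SUN N) → ℝ} {ΛF ΛG : Finset (ZdEdge d)} {KF KG MF MG : ℝ≥0}
    (hF : IsLipschitzCylinder (fundamentalRep (Fin N)) F ΛF KF) (hMF : ∀ U, |F U| ≤ MF)
    (hG : IsLipschitzCylinder (fundamentalRep (Fin N)) G ΛG KG) (hMG : ∀ U, |G U| ≤ MG)
    (hn₁ : (ΛF ∪ S).card ≤ n) (hn₂ : (ΛG ∪ S).card ≤ n) (hdisj : Disjoint ΛF ΛG) :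
    |cov[F, G; ν]| ≤ A * (n : ℝ) ^ 2 * exp (2 * B) * exp (m * δ / 2) * exp (-(m / 2) * setDistEdges ΛF ΛG) *
      ((KF : ℝ) * KG + 2 * (∑ X ∈ T, K X : ℝ≥0) * (MF * KG + MG * KF) + 2 * MF * MG) := by
  have hWa : W.IsAdapted := fun X => ⟨hW.dependsOn X, (hW.continuous X).measurable⟩
  have hWb : ∀ X, ∃ C, ∀ U, |W X U| ≤ C := fun X => exists_bound_of_continuous (hW.continuous X)
  obtain ⟨μ, hμ⟩ := (h.2 W supp hW).1.2
  exact abs_cov_le_halfRate_of_mem_perturbedGibbsMeasures_add (h.2 W supp hW).2 h.1.le hA hWa hWb hW.supportedBy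
    (h.2 W supp hW).1.1 hμ hVa hVb hsuppV hT hV hS hB hδ0 hδ hν hF hMF hG hMG hn₁ hn₂ hdisj

/-- **TIER 2 — EVERY DLR STATE OF THE SUMMABLE MEMBER `W + V` HAS A MASS GAP AT LEAST `m/2`** (`W` link-summable with continuous own-link
terms and at most one DLR state `μ` clustering with `PerturbedClusteringS d N β W m A`, `m ≥ 0`, `A ≥ 1`; source with continuous own-link
Lipschitz-cylinder terms on sets `X ⊆ S`, `|Σ_X V_X| ≤ B`, `S` of diameter `≤ δ`). -/
theorem abs_cov_le_halfRate_of_mem_perturbedGibbsMeasuresS_add (hcl : PerturbedClusteringS d N β W m A) (hm : 0 ≤ m) (hA : 1 ≤ A)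
    {Bm : Finset (ZdEdge d) → ℝ} (hWs : IsLinkSummable W Bm) (hWc : ∀ X, Continuous (W X))
    (hWdep : ∀ X, DependsOn (W X) (↑X : Set (ZdEdge d)))
    (huniq : (perturbedGibbsMeasuresS (d := d) (fundamentalRep (Fin N)) (N * β) W).Subsingleton)
    {μ : Measure (LGConfig d (SUN N))} (hμ : μ ∈ perturbedGibbsMeasuresS (d := d) (fundamentalRep (Fin N)) (N * β) W)
    {V : Potential (ZdEdge d) (SUN N)} (hVc : ∀ X, Continuous (V X)) (hVdep : ∀ X, DependsOn (V X) (↑X : Set (ZdEdge d)))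
    {suppV : Finset (ZdEdge d) → Finset (Finset (ZdEdge d))} (hsuppV : V.IsSupportedBy suppV)
    {T : Finset (Finset (ZdEdge d))} (hT : ∀ Λ, suppV Λ ⊆ T)
    {K : Finset (ZdEdge d) → ℝ≥0} (hV : ∀ X ∈ T, IsLipschitzCylinder (fundamentalRep (Fin N)) (V X) X (K X))
    {S : Finset (ZdEdge d)} (hS : ∀ X ∈ T, X ⊆ S) {B : ℝ} (hB : ∀ U, |∑ X ∈ T, V X U| ≤ B)
    {δ : ℝ} (hδ0 : 0 ≤ δ) (hδ : ∀ s ∈ S, ∀ s' ∈ S, ‖s.1 - s'.1‖ ≤ δ)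
    {ν : Measure (LGConfig d (SUN N))}
    (hν : ν ∈ perturbedGibbsMeasuresS (d := d) (fundamentalRep (Fin N)) (N * β) (W + V))
    {n : ℕ} {F G : LGConfig d (SUN N) → ℝ} {ΛF ΛG : Finset (ZdEdge d)} {KF KG MF MG : ℝ≥0}
    (hF : IsLipschitzCylinder (fundamentalRep (Fin N)) F ΛF KF) (hMF : ∀ U, |F U| ≤ MF)
    (hG : IsLipschitzCylinder (fundamentalRep (Fin N)) G ΛG KG) (hMG : ∀ U, |G U| ≤ MG)
    (hn₁ : (ΛF ∪ S).card ≤ n) (hn₂ : (ΛG ∪ S).card ≤ n) (hdisj : Disjoint ΛF ΛG) :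
    |cov[F, G; ν]| ≤ A * (n : ℝ) ^ 2 * exp (2 * B) * exp (m * δ / 2) * exp (-(m / 2) * setDistEdges ΛF ΛG) *
      ((KF : ℝ) * KG + 2 * (∑ X ∈ T, K X : ℝ≥0) * (MF * KG + MG * KF) + 2 * MF * MG) := by
  haveI : SecondCountableTopology (Matrix (Fin N) (Fin N) ℂ) :=
    inferInstanceAs (SecondCountableTopology (Fin N → Fin N → ℂ))
  haveI : SecondCountableTopology (SUN N) := Topology.IsEmbedding.subtypeVal.secondCountableTopology
  have hνeq := eq_tilted_of_mem_perturbedGibbsMeasuresS_add (fundamentalRep (Fin N)) (continuous_fundamentalRep (Fin N)) (N * β)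
    hWs hWc hWdep hVc hVdep hsuppV hT huniq hμ hν
  rw [hνeq]
  exact abs_cov_tilted_le_halfRate_S hcl hm hA hμ (isLipschitzCylinder_finset_sum hV hS) hB hδ0 hδ hF hMF hG hMG hn₁ hn₂ hdisj

/-- **ON THE WEIGHTED TIER-2 BALL** (`UniformMassGapOnBallZdS d N β a Λ t m A`, `A ≥ 1`, member `W ∈ MemBallZdS a Λ t`): every DLR state of
`W + V` has a mass gap at least `m/2` in the sense of `abs_cov_le_halfRate_of_mem_perturbedGibbsMeasuresS_add`. -/
theorem abs_cov_le_halfRate_of_uniformMassGapOnBallZdS_add {a Λ t : ℝ} (h : UniformMassGapOnBallZdS d N β a Λ t m A) (hA : 1 ≤ A)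
    (hW : MemBallZdS a Λ t W)
    {V : Potential (ZdEdge d) (SUN N)} (hVc : ∀ X, Continuous (V X)) (hVdep : ∀ X, DependsOn (V X) (↑X : Set (ZdEdge d)))
    {suppV : Finset (ZdEdge d) → Finset (Finset (ZdEdge d))} (hsuppV : V.IsSupportedBy suppV)
    {T : Finset (Finset (ZdEdge d))} (hT : ∀ Λ, suppV Λ ⊆ T)
    {K : Finset (ZdEdge d) → ℝ≥0} (hV : ∀ X ∈ T, IsLipschitzCylinder (fundamentalRep (Fin N)) (V X) X (K X))
    {S : Finset (ZdEdge d)} (hS : ∀ X ∈ T, X ⊆ S) {B : ℝ} (hB : ∀ U, |∑ X ∈ T, V X U| ≤ B)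
    {δ : ℝ} (hδ0 : 0 ≤ δ) (hδ : ∀ s ∈ S, ∀ s' ∈ S, ‖s.1 - s'.1‖ ≤ δ)
    {ν : Measure (LGConfig d (SUN N))}
    (hν : ν ∈ perturbedGibbsMeasuresS (d := d) (fundamentalRep (Fin N)) (N * β) (W + V))
    {n : ℕ} {F G : LGConfig d (SUN N) → ℝ} {ΛF ΛG : Finset (ZdEdge d)} {KF KG MF MG : ℝ≥0}
    (hF : IsLipschitzCylinder (fundamentalRep (Fin N)) F ΛF KF) (hMF : ∀ U, |F U| ≤ MF)
    (hG : IsLipschitzCylinder (fundamentalRep (Fin N)) G ΛG KG) (hMG : ∀ U, |G U| ≤ MG)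
    (hn₁ : (ΛF ∪ S).card ≤ n) (hn₂ : (ΛG ∪ S).card ≤ n) (hdisj : Disjoint ΛF ΛG) :
    |cov[F, G; ν]| ≤ A * (n : ℝ) ^ 2 * exp (2 * B) * exp (m * δ / 2) * exp (-(m / 2) * setDistEdges ΛF ΛG) *
      ((KF : ℝ) * KG + 2 * (∑ X ∈ T, K X : ℝ≥0) * (MF * KG + MG * KF) + 2 * MF * MG) := by
  obtain ⟨Bm, hBm⟩ := hW.summable
  obtain ⟨μ, hμ⟩ := (h.2 W hW).1.2
  exact abs_cov_le_halfRate_of_mem_perturbedGibbsMeasuresS_add (h.2 W hW).2 h.1.le hA hBm hW.continuous hW.dependsOn (h.2 W hW).1.1 hμ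
    hVc hVdep hsuppV hT hV hS hB hδ0 hδ hν hF hMF hG hMG hn₁ hn₂ hdisj

end MassGap


end Summit.Ventures.YMGap.RobustBall

end
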